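import Summits.AtomisticToContinuum.FouriersLaw.Theorems.BondHeatUncertaintyExtensiveSnapshotIrreversibilitySnapshotKLUpperReduction

/-!
# Crux `ExtensiveSnapshotIrreversibility` (stmt-AtomisticToContinuum-9121), line `hellinger-logmean`:
stub S_H0 `stub_klDiv_flip_le_logMeanHellinger`

For ONE positive measurable Lebesgue probability density `ρ` on phase space whose odd log-ratio
`d := log ρ − log ρ∘Θ` (`Θ(q,p) = (q,−p)`) is dominated, `|d| ≤ 2η(1+H)`, and whose weighted odd
Hellinger integrand `(√ρ − √ρ∘Θ)² cosh(η(1+H))` is Lebesgue integrable: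
`KL(ρ dx ‖ Θ_*(ρ dx)) ≤ 2 ∫ (√ρ − √ρ∘Θ)² cosh(η(1+H)) dx`.

Route: (1) pointwise, with `a = ρ(x)`, `b = ρ(Θx)`, `u = d/2`, `e^c = √(ab)`:
`(a − b)(log a − log b) = 4e^c · u sinh u ≤ 4e^c · 2(cosh u − 1)cosh u = 4(√a − √b)² cosh(d/2)`
(`|u| ≤ |sinh u|`, i.e. logarithmic mean ≥ geometric mean) and
`a|log a − log b| ≤ 2(a + b) + 2(√a − √b)² cosh(d/2)` (`e^u ≤ 2cosh u`, `|u| ≤ cosh u`), then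
`cosh(d/2) ≤ cosh(η(1+H))`; (2) `ρ·d ∈ L¹(dx)` by the second bound, `∫ ρ∘Θ · d = −∫ ρ · d` (Lebesgue
measure is flip-invariant, `d` is odd), so `2∫ρ d = ∫(ρ − ρ∘Θ)d ≤ 4∫(√ρ − √ρ∘Θ)² cosh(η(1+H))`;
(3) `KL(ρ dx ‖ Θ_*(ρ dx)) = ofReal ∫ ρ d dx`: write `ρ dx` as the tilt of the (flip-invariant,
probability) Gibbs state of an AUXILIARY harmonic chain (`pinnedChain 1 0 0 0` at `T = 1`) by
`log ρ + H₀` (`ClausiusBudget.withDensity_eq_gibbs_tilted`) and use the landed tilted-flip calculus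
`Negative.toReal_klDiv_flip_tilted` / `Negative.klDiv_flip_tilted_ne_top_iff` (the auxiliary
Hamiltonian is even in the momenta, so the tilt's odd part is `d`).  No hypothesis on the chain
parameters `ω₂ lam β γ` or on `η` is used: the statement's Hamiltonian only enters the weight.
-/

noncomputable section

namespace Summit.AtomisticToContinuum.FouriersLaw.Theorems.ExtensiveSnapshotIrreversibility.HellingerLogMean

open MeasureTheory Filter Topology InformationTheory Real
open scoped ENNReal NNReal
open Literature.MathematicalPhysics.KineticTheory.HeatConduction
open Summit.AtomisticToContinuum.FouriersLaw.Theorems.ExtensiveSnapshotIrreversibility.Negative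
open Summit.AtomisticToContinuum.FouriersLaw.Theorems.ExtensiveSnapshotIrreversibility.ClausiusBudget

/-! ## 1. Pointwise inequalities -/

/-- `u sinh u ≤ 2 (cosh u − 1) cosh u` (from `|u| ≤ |sinh u|` and `sinh² = cosh² − 1`). [folklore] -/
theorem mul_sinh_le_two_mul (u : ℝ) : u * sinh u ≤ 2 * (cosh u - 1) * cosh u := by
  have h1 : u * sinh u ≤ sinh u ^ 2 := by
    rcases le_total 0 u with h | h
    · have := Real.self_le_sinh_iff.2 h
      have hs : 0 ≤ sinh u := Real.sinh_nonneg_iff.2 h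
      nlinarith
    · have := Real.sinh_le_self_iff.2 h
      have hs : sinh u ≤ 0 := Real.sinh_nonpos_iff.2 h
      nlinarith
  nlinarith [Real.cosh_sq u, sq_nonneg (cosh u - 1)]

/-- `|u| ≤ cosh u`. [folklore] -/
theorem abs_le_cosh (u : ℝ) : |u| ≤ cosh u := by
  rcases le_total 0 u with h | h
  · rw [abs_of_nonneg h]
    exact (Real.self_le_sinh_iff.2 h).trans (Real.sinh_lt_cosh u).le
  · rw [abs_of_nonpos h, ← Real.cosh_neg]
    exact (Real.self_le_sinh_iff.2 (neg_nonneg.2 h)).trans (Real.sinh_lt_cosh (-u)).le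

/-- `cosh` comparison from a two-sided envelope: `|a| ≤ 2e ⟹ cosh(a/2) ≤ cosh e`. [folklore] -/
theorem cosh_half_le_cosh {a e : ℝ} (h : |a| ≤ 2 * e) : cosh (a / 2) ≤ cosh e := by
  rw [Real.cosh_le_cosh, abs_div, abs_two]
  have : |a| / 2 ≤ e := by linarith
  exact this.trans (le_abs_self e)

/-- **Logarithmic-mean / Hellinger pointwise bound**: for `a, b > 0`,
`(a − b)(log a − log b) ≤ 4 (√a − √b)² cosh((log a − log b)/2)`. [folklore] -/
theorem sub_mul_log_sub_log_le {a b : ℝ} (ha : 0 < a) (hb : 0 < b) :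
    (a - b) * (log a - log b) ≤ 4 * (sqrt a - sqrt b) ^ 2 * cosh ((log a - log b) / 2) := by
  set c := (log a + log b) / 2 with hc
  set u := (log a - log b) / 2 with hu
  have hac : log a = c + u := by rw [hc, hu]; ring
  have hbc : log b = c + -u := by rw [hc, hu]; ring
  have ha' : a = exp c * exp u := by rw [← exp_add, ← hac, exp_log ha]
  have hb' : b = exp c * exp (-u) := by rw [← exp_add, ← hbc, exp_log hb]
  have hsa : sqrt a = exp (c / 2) * exp (u / 2) := by
    rw [ha', ← exp_add, ← exp_add, ← Real.exp_half]; congr 1; ring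
  have hsb : sqrt b = exp (c / 2) * exp (-u / 2) := by
    rw [hb', ← exp_add, ← exp_add, ← Real.exp_half]; congr 1; ring
  have hsq : (sqrt a - sqrt b) ^ 2 = exp c * (2 * cosh u - 2) := by
    rw [hsa, hsb, Real.cosh_eq]
    have h1 : exp (c / 2) * exp (c / 2) = exp c := by rw [← exp_add]; congr 1; ring
    have h2 : exp (u / 2) * exp (u / 2) = exp u := by rw [← exp_add]; congr 1; ring
    have h3 : exp (-u / 2) * exp (-u / 2) = exp (-u) := by rw [← exp_add]; congr 1; ring
    have h4 : exp (u / 2) * exp (-u / 2) = 1 := by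
      rw [← exp_add, show u / 2 + -u / 2 = 0 by ring, exp_zero]
    nlinarith [h1, h2, h3, h4]
  have hd : a - b = exp c * (2 * sinh u) := by rw [ha', hb', Real.sinh_eq]; ring
  rw [hsq, hd]
  have key := mul_le_mul_of_nonneg_left (mul_sinh_le_two_mul u) (exp_pos c).le
  nlinarith [key, exp_pos c]

/-- **Integrability pointwise bound**: for `a, b > 0`,
`a |log a − log b| ≤ 2(a + b) + 2 (√a − √b)² cosh((log a − log b)/2)`. [folklore] -/
theorem mul_abs_log_sub_log_le {a b : ℝ} (ha : 0 < a) (hb : 0 < b) :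
    a * |log a - log b| ≤
      2 * (a + b) + 2 * ((sqrt a - sqrt b) ^ 2 * cosh ((log a - log b) / 2)) := by
  set c := (log a + log b) / 2 with hc
  set u := (log a - log b) / 2 with hu
  have hac : log a = c + u := by rw [hc, hu]; ring
  have hbc : log b = c + -u := by rw [hc, hu]; ring
  have ha' : a = exp c * exp u := by rw [← exp_add, ← hac, exp_log ha]
  have hb' : b = exp c * exp (-u) := by rw [← exp_add, ← hbc, exp_log hb]
  have hsa : sqrt a = exp (c / 2) * exp (u / 2) := by
    rw [ha', ← exp_add, ← exp_add, ← Real.exp_half]; congr 1; ring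
  have hsb : sqrt b = exp (c / 2) * exp (-u / 2) := by
    rw [hb', ← exp_add, ← exp_add, ← Real.exp_half]; congr 1; ring
  have hsq : (sqrt a - sqrt b) ^ 2 = exp c * (2 * cosh u - 2) := by
    rw [hsa, hsb, Real.cosh_eq]
    have h1 : exp (c / 2) * exp (c / 2) = exp c := by rw [← exp_add]; congr 1; ring
    have h2 : exp (u / 2) * exp (u / 2) = exp u := by rw [← exp_add]; congr 1; ring
    have h3 : exp (-u / 2) * exp (-u / 2) = exp (-u) := by rw [← exp_add]; congr 1; ring
    have h4 : exp (u / 2) * exp (-u / 2) = 1 := by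
      rw [← exp_add, show u / 2 + -u / 2 = 0 by ring, exp_zero]
    nlinarith [h1, h2, h3, h4]
  have hsum : a + b = exp c * (2 * cosh u) := by rw [ha', hb', Real.cosh_eq]; ring
  have hdabs : |log a - log b| = 2 * |u| := by
    rw [show log a - log b = 2 * u by rw [hu]; ring, abs_mul, abs_two]
  rw [hsq, hsum, hdabs, ha']
  have h1 : exp u ≤ 2 * cosh u := by rw [Real.cosh_eq]; nlinarith [exp_pos (-u)]
  have h2 := abs_le_cosh u
  have h3 : exp u * |u| ≤ 2 * cosh u * cosh u :=
    mul_le_mul h1 h2 (abs_nonneg u) (by positivity)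
  nlinarith [mul_le_mul_of_nonneg_left h3 (exp_pos c).le, exp_pos c]

/-! ## 2. Integrated: `ρ·d ∈ L¹` and `∫ ρ d ≤ 2 ∫ (√ρ − √ρ∘Θ)² cosh E` -/

variable {N : ℕ}

/-- For a positive measurable integrable `ρ` with `|log ρ − log ρ∘Θ| ≤ 2E` and
`(√ρ − √ρ∘Θ)² cosh E ∈ L¹(dx)`: `ρ · (log ρ − log ρ∘Θ) ∈ L¹(dx)`. [folklore] -/
theorem integrable_mul_logRatio {ρ E : PhaseSpace N → ℝ} (hρm : Measurable ρ)
    (hρpos : ∀ x, 0 < ρ x) (hρint : Integrable ρ (volume : Measure (PhaseSpace N)))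
    (hdom : ∀ x : PhaseSpace N, |Real.log (ρ x) - Real.log (ρ (x.1, -x.2))| ≤ 2 * E x)
    (hW : Integrable (fun x : PhaseSpace N => (Real.sqrt (ρ x) - Real.sqrt (ρ (x.1, -x.2))) ^ 2 *
        Real.cosh (E x)) (volume : Measure (PhaseSpace N))) :
    Integrable (fun x => ρ x * (Real.log (ρ x) - Real.log (ρ (x.1, -x.2))))
      (volume : Measure (PhaseSpace N)) := by
  have hvol : Measure.map (fun x : PhaseSpace N => (x.1, -x.2)) (volume : Measure (PhaseSpace N)) =
      volume := (measurePreserving_momentumReversal N).map_eq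
  have hΘm : Measurable (fun x : PhaseSpace N => (x.1, -x.2)) := (momentumReversal N).measurable
  have hρ'int : Integrable (fun x : PhaseSpace N => ρ (x.1, -x.2)) (volume : Measure (PhaseSpace N)) :=
    (integrable_comp_flip_iff volume hvol ρ).2 hρint
  have hdm : Measurable (fun x : PhaseSpace N => Real.log (ρ x) - Real.log (ρ (x.1, -x.2))) :=
    hρm.log.sub (hρm.comp hΘm).log
  have hmaj : Integrable (fun x : PhaseSpace N => 2 * (ρ x + ρ (x.1, -x.2)) +
      2 * ((Real.sqrt (ρ x) - Real.sqrt (ρ (x.1, -x.2))) ^ 2 * Real.cosh (E x)))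
      (volume : Measure (PhaseSpace N)) :=
    ((hρint.add hρ'int).const_mul 2).add (hW.const_mul 2)
  refine hmaj.mono' (hρm.mul hdm).aestronglyMeasurable (ae_of_all _ fun x => ?_)
  rw [Real.norm_eq_abs, abs_mul, abs_of_pos (hρpos x)]
  have h1 := mul_abs_log_sub_log_le (hρpos x) (hρpos (x.1, -x.2))
  have h2 : (Real.sqrt (ρ x) - Real.sqrt (ρ (x.1, -x.2))) ^ 2 *
      Real.cosh ((Real.log (ρ x) - Real.log (ρ (x.1, -x.2))) / 2) ≤
      (Real.sqrt (ρ x) - Real.sqrt (ρ (x.1, -x.2))) ^ 2 * Real.cosh (E x) :=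
    mul_le_mul_of_nonneg_left (cosh_half_le_cosh (hdom x)) (sq_nonneg _)
  linarith

/-- For a positive measurable integrable `ρ` with `|log ρ − log ρ∘Θ| ≤ 2E` and
`(√ρ − √ρ∘Θ)² cosh E ∈ L¹(dx)`: `∫ ρ (log ρ − log ρ∘Θ) dx ≤ 2 ∫ (√ρ − √ρ∘Θ)² cosh E dx`
(half-Jeffreys symmetrisation under the volume-preserving flip, then the log-mean bound). [folklore] -/
theorem integral_mul_logRatio_le {ρ E : PhaseSpace N → ℝ} (hρm : Measurable ρ)
    (hρpos : ∀ x, 0 < ρ x) (hρint : Integrable ρ (volume : Measure (PhaseSpace N)))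
    (hdom : ∀ x : PhaseSpace N, |Real.log (ρ x) - Real.log (ρ (x.1, -x.2))| ≤ 2 * E x)
    (hW : Integrable (fun x : PhaseSpace N => (Real.sqrt (ρ x) - Real.sqrt (ρ (x.1, -x.2))) ^ 2 *
        Real.cosh (E x)) (volume : Measure (PhaseSpace N))) :
    ∫ x, ρ x * (Real.log (ρ x) - Real.log (ρ (x.1, -x.2))) ∂(volume : Measure (PhaseSpace N)) ≤
      2 * ∫ x, (Real.sqrt (ρ x) - Real.sqrt (ρ (x.1, -x.2))) ^ 2 * Real.cosh (E x)
        ∂(volume : Measure (PhaseSpace N)) := by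
  have hvol : Measure.map (fun x : PhaseSpace N => (x.1, -x.2)) (volume : Measure (PhaseSpace N)) =
      volume := (measurePreserving_momentumReversal N).map_eq
  have hρd := integrable_mul_logRatio hρm hρpos hρint hdom hW
  -- the flipped weight
  have hρ'd : Integrable (fun x => ρ (x.1, -x.2) * (Real.log (ρ x) - Real.log (ρ (x.1, -x.2))))
      (volume : Measure (PhaseSpace N)) := by
    have h := (integrable_comp_flip_iff volume hvol
      (fun x => -(ρ x * (Real.log (ρ x) - Real.log (ρ (x.1, -x.2)))))).2 hρd.neg
    refine h.congr (ae_of_all _ fun x => ?_)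
    simp only [neg_neg, Prod.mk.eta]
    ring
  -- oddness: `∫ ρ∘Θ · d = -∫ ρ · d`
  have hI : ∫ x, ρ (x.1, -x.2) * (Real.log (ρ x) - Real.log (ρ (x.1, -x.2)))
        ∂(volume : Measure (PhaseSpace N)) =
      -∫ x, ρ x * (Real.log (ρ x) - Real.log (ρ (x.1, -x.2))) ∂(volume : Measure (PhaseSpace N)) := by
    rw [← integral_neg, ← integral_comp_flip volume hvol
      (fun x => -(ρ x * (Real.log (ρ x) - Real.log (ρ (x.1, -x.2)))))]
    refine integral_congr_ae (ae_of_all _ fun x => ?_)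
    simp only [neg_neg, Prod.mk.eta]
    ring
  -- pointwise log-mean bound, integrated
  have hpt : ∀ x : PhaseSpace N,
      ρ x * (Real.log (ρ x) - Real.log (ρ (x.1, -x.2))) -
        ρ (x.1, -x.2) * (Real.log (ρ x) - Real.log (ρ (x.1, -x.2))) ≤
      4 * ((Real.sqrt (ρ x) - Real.sqrt (ρ (x.1, -x.2))) ^ 2 * Real.cosh (E x)) := fun x => by
    have h1 := sub_mul_log_sub_log_le (hρpos x) (hρpos (x.1, -x.2))
    have h2 : (Real.sqrt (ρ x) - Real.sqrt (ρ (x.1, -x.2))) ^ 2 *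
        Real.cosh ((Real.log (ρ x) - Real.log (ρ (x.1, -x.2))) / 2) ≤
        (Real.sqrt (ρ x) - Real.sqrt (ρ (x.1, -x.2))) ^ 2 * Real.cosh (E x) :=
      mul_le_mul_of_nonneg_left (cosh_half_le_cosh (hdom x)) (sq_nonneg _)
    nlinarith [h1, h2]
  have hint := integral_mono (hρd.sub hρ'd) (hW.const_mul 4) hpt
  rw [integral_sub' hρd hρ'd, integral_const_mul, hI] at hint
  linarith

/-! ## 3. The snapshot divergence of a positive Lebesgue density against its flip -/

/-- **`KL(ρ dx ‖ Θ_*(ρ dx)) = ofReal ∫ ρ (log ρ − log ρ∘Θ) dx`** for a positive measurable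
Lebesgue probability density `ρ` with `ρ (log ρ − log ρ∘Θ) ∈ L¹(dx)`: the density is the tilt
of the flip-invariant Gibbs probability measure of the auxiliary chain `pinnedChain 1 0 0 0` at
`T = 1` by `log ρ + H₀` (`withDensity_eq_gibbs_tilted`), whose odd part is `log ρ − log ρ∘Θ`;
then `toReal_klDiv_flip_tilted` and `klDiv_flip_tilted_ne_top_iff`. [folklore] -/
theorem klDiv_withDensity_flip_eq_ofReal {ρ : PhaseSpace N → ℝ} (hρm : Measurable ρ)
    (hρpos : ∀ x, 0 < ρ x)
    (hρ1 : (∫⁻ x, ENNReal.ofReal (ρ x) ∂(volume : Measure (PhaseSpace N))) = 1)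
    (hρd : Integrable (fun x => ρ x * (Real.log (ρ x) - Real.log (ρ (x.1, -x.2))))
      (volume : Measure (PhaseSpace N))) :
    klDiv ((volume : Measure (PhaseSpace N)).withDensity (fun x => ENNReal.ofReal (ρ x)))
        (Measure.map (fun x : PhaseSpace N => (x.1, -x.2))
          ((volume : Measure (PhaseSpace N)).withDensity (fun x => ENNReal.ofReal (ρ x)))) =
      ENNReal.ofReal (∫ x, ρ x * (Real.log (ρ x) - Real.log (ρ (x.1, -x.2)))
        ∂(volume : Measure (PhaseSpace N))) := by
  -- the auxiliary flip-invariant Gibbs probability measure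
  have hZ : Integrable ((pinnedChain 1 0 0 0).gibbsDensity N 1) (volume : Measure (PhaseSpace N)) :=
    pinnedChain_integrable_gibbsDensity one_pos le_rfl le_rfl 0 N one_pos
  haveI : IsProbabilityMeasure ((pinnedChain 1 0 0 0).gibbsMeasure N 1) :=
    pinnedChain_isProbabilityMeasure_gibbsMeasure one_pos le_rfl le_rfl 0 N one_pos
  have hinv := gibbsMeasure_map_flip (pinnedChain 1 0 0 0) N 1
  have hρnn : ∀ x, 0 ≤ ρ x := fun x => (hρpos x).le
  have hρint : Integrable ρ (volume : Measure (PhaseSpace N)) := by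
    refine ⟨hρm.aestronglyMeasurable, ?_⟩
    rw [hasFiniteIntegral_iff_ofReal (ae_of_all _ hρnn), hρ1]
    exact ENNReal.one_lt_top
  have hρI1 : ∫ x, ρ x ∂(volume : Measure (PhaseSpace N)) = 1 := by
    rw [integral_eq_lintegral_of_nonneg_ae (ae_of_all _ hρnn) hρm.aestronglyMeasurable, hρ1,
      ENNReal.toReal_one]
  have hφm : Measurable (fun x => Real.log (ρ x) + (pinnedChain 1 0 0 0).hamiltonian N x / 1) :=
    hρm.log.add ((pinnedChain_continuous_hamiltonian 1 0 0 0 N).measurable.div_const 1)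
  have hexp := integrable_exp_log_add_hamiltonian_gibbs (pinnedChain 1 0 0 0) N 1 hZ hρpos hρint
  have hρeq := withDensity_eq_gibbs_tilted (pinnedChain 1 0 0 0) N 1 hZ hρpos hρI1
  have hφd : ∀ x : PhaseSpace N,
      (Real.log (ρ x) + (pinnedChain 1 0 0 0).hamiltonian N x / 1) -
        (Real.log (ρ (x.1, -x.2)) + (pinnedChain 1 0 0 0).hamiltonian N (x.1, -x.2) / 1) =
      Real.log (ρ x) - Real.log (ρ (x.1, -x.2)) := fun x => by
    rw [OscillatorChain.hamiltonian_neg_momentum]; ring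
  have hlt : ∀ᵐ x ∂(volume : Measure (PhaseSpace N)), ENNReal.ofReal (ρ x) < ∞ :=
    ae_of_all _ fun x => ENNReal.ofReal_lt_top
  -- the log-likelihood ratio is integrable under the state
  have hint : Integrable (fun x => (Real.log (ρ x) + (pinnedChain 1 0 0 0).hamiltonian N x / 1) -
      (Real.log (ρ (x.1, -x.2)) + (pinnedChain 1 0 0 0).hamiltonian N (x.1, -x.2) / 1))
      (((pinnedChain 1 0 0 0).gibbsMeasure N 1).tilted
        (fun x => Real.log (ρ x) + (pinnedChain 1 0 0 0).hamiltonian N x / 1)) := by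
    rw [← hρeq, integrable_withDensity_iff_integrable_smul' hρm.ennreal_ofReal hlt]
    refine hρd.congr (ae_of_all _ fun x => ?_)
    dsimp only
    rw [hφd x, ENNReal.toReal_ofReal (hρnn x), smul_eq_mul]
  have hfin := (klDiv_flip_tilted_ne_top_iff hinv hφm hexp).2 hint
  rw [hρeq, ← ENNReal.ofReal_toReal hfin, toReal_klDiv_flip_tilted hinv hφm hexp]
  congr 1
  rw [← hρeq, integral_withDensity_eq_integral_toReal_smul hρm.ennreal_ofReal hlt]
  refine integral_congr_ae (ae_of_all _ fun x => ?_)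
  dsimp only
  rw [hφd x, ENNReal.toReal_ofReal (hρnn x), smul_eq_mul]

/-! ## 4. The registered stub -/

/-- **S_H0 `stub_klDiv_flip_le_logMeanHellinger`** (any `N`, ONE density).  For a positive
measurable probability density `ρ` on phase space whose odd log-ratio is dominated,
`|log ρ − log ρ∘Θ| ≤ 2η(1+H)`, and whose weighted odd Hellinger integrand is integrable:
`KL(ρ dx ‖ Θ_*(ρ dx)) ≤ 2∫(√ρ − √ρ∘Θ)² cosh(η(1+H)) dx`
(half-Jeffreys identity for the volume-preserving involution `Θ`, logarithmic-mean inequality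
`(a−b)(log a−log b) ≤ (a−b)²/√(ab) ≤ 4(√a−√b)² cosh(d/2)`, `cosh(d/2) ≤ cosh(η(1+H))`; the
integrability hypothesis keeps the Bochner integral honest and yields `llr ∈ L¹`). [folklore] -/
theorem stub_klDiv_flip_le_logMeanHellinger :
    ∀ ω₂ lam β γ : ℝ, ∀ (N : ℕ) (η : ℝ) (ρ : PhaseSpace N → ℝ), Measurable ρ → (∀ x, 0 < ρ x) →
      (∫⁻ x, ENNReal.ofReal (ρ x) ∂(volume : Measure (PhaseSpace N))) = 1 →
      (∀ x : PhaseSpace N, |Real.log (ρ x) - Real.log (ρ (x.1, -x.2))| ≤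
        2 * (η * (1 + (pinnedChain ω₂ lam β γ).hamiltonian N x))) →
      Integrable (fun x : PhaseSpace N => (Real.sqrt (ρ x) - Real.sqrt (ρ (x.1, -x.2))) ^ 2 *
        Real.cosh (η * (1 + (pinnedChain ω₂ lam β γ).hamiltonian N x))) (volume : Measure (PhaseSpace N)) →
      klDiv ((volume : Measure (PhaseSpace N)).withDensity (fun x => ENNReal.ofReal (ρ x)))
          (Measure.map (fun x : PhaseSpace N => (x.1, -x.2))
            ((volume : Measure (PhaseSpace N)).withDensity (fun x => ENNReal.ofReal (ρ x))))
        ≤ ENNReal.ofReal (2 * ∫ x, (Real.sqrt (ρ x) - Real.sqrt (ρ (x.1, -x.2))) ^ 2 *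
            Real.cosh (η * (1 + (pinnedChain ω₂ lam β γ).hamiltonian N x)) ∂(volume : Measure (PhaseSpace N))) := by
  intro ω₂ lam β γ N η ρ hρm hρpos hρ1 hdom hW
  have hρnn : ∀ x, 0 ≤ ρ x := fun x => (hρpos x).le
  have hρint : Integrable ρ (volume : Measure (PhaseSpace N)) := by
    refine ⟨hρm.aestronglyMeasurable, ?_⟩
    rw [hasFiniteIntegral_iff_ofReal (ae_of_all _ hρnn), hρ1]
    exact ENNReal.one_lt_top
  have hρd := integrable_mul_logRatio
    (E := fun x => η * (1 + (pinnedChain ω₂ lam β γ).hamiltonian N x)) hρm hρpos hρint hdom hW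
  rw [klDiv_withDensity_flip_eq_ofReal hρm hρpos hρ1 hρd]
  exact ENNReal.ofReal_le_ofReal (integral_mul_logRatio_le
    (E := fun x => η * (1 + (pinnedChain ω₂ lam β γ).hamiltonian N x)) hρm hρpos hρint hdom hW)

end Summit.AtomisticToContinuum.FouriersLaw.Theorems.ExtensiveSnapshotIrreversibility.HellingerLogMean

end
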